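import Summits.HodgeConjecture.HodgeConjecture.Theorems.VHCAbelianSchemesRoadRegimeDefs
import HarnessLib

/-!
# Road b02 (`VHCAbelianSchemesRoad`, D-0059) — THE SERVED-FIBRE PARTITION of a cell `(n, p)` of K-SR♭∃, ANCHOR-GENERIC (definitions only)

research route conditional on HC_CM; not a corollary; Q11.4-sentence-2 already refuted in dim ≥ 3.

DEFINITIONS ONLY (nothing asserted, nothing proved, `HC_CM` absent). A cell `LefAtExceptionalRegimeAt 𝒪 n p` of the road's crux
(`VHCAbelianSchemesRoadRegimeDefs` §2; the crux `SemiregularSheafRepresentativesTwAtDiag`, item stmt-HodgeConjecture-19787, is the conjunction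
of the diagonal cells `(2m, m)`, `m ≥ 2`, for the twisted door) asks for a datum at SOME fibre of EVERY one-parameter abelian scheme carrying a
somewhere-exceptional class `W`. The only carriers in print (Markman's secant sheaves, arXiv:2502.03415 Thm. 1.4.1, PREPRINT) live on SPECIAL
varieties — ANCHORS — and serve SPECIAL classes there. This file types, once and for all anchors, the three constants by which a cell is
PARTITIONED along «does the pencil pass through a served anchor fibre?»:

* `LefAtExceptionalRegimeAtUnder 𝒪 n p P` — the cell `(n, p)` UNDER an extra pencil-level hypothesis `P f W`: the body of
  `LefAtExceptionalRegimeAt 𝒪 n p` VERBATIM with `P f W →` inserted before the conclusion. By excluded middle on `P f W`,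
  `…Under 𝒪 n p P ∧ …Under 𝒪 n p ¬P ↔ LefAtExceptionalRegimeAt 𝒪 n p` is pure logic (companion file), so a partition of a cell into a
  «through-anchor» piece and a «residual» piece can hide no narrowing of the cell.
* `HasServedFibre n p 𝔄 𝔖 f W` — the ONE pencil-level predicate of the partition, for an ANCHOR PREDICATE
  `𝔄 : Π X, H²(X(ℂ); ℂ) → Prop` (a variety `X` with a distinguished degree-2 class `θ` — a polarisation class in every intended instance —
  IS an anchor) and a SERVED-CLASS MAP `𝔖 : Π X θ, Set H^{2p}(X(ℂ); ℂ)` (the classes the anchor's carriers serve): SOME fibre `𝒳_{sₐ}` of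
  `f`, polarised by the restriction of a GLOBAL class `Θ ∈ H²(𝒳(ℂ); ℂ)` with rational `(1,1)` restrictions on EVERY fibre, is an anchor, and
  `W|_{sₐ}` is served there. The global `Θ` is not decoration: a carrier's side components ride on the `θ`-ray and must extend to fibrewise
  `(q,q)` global classes `c_q·Θ^q` (PART Z-b §5 `exists_lefAtDatum_of_pinnedDatum_at`).
* `AnchoredCarrierAt 𝒪 n p 𝔄 𝔖` — the PER-VARIETY CARRIER STATEMENT at the anchors: at every anchor `(X, θ)` and every served RATIONAL class
  `w`, an `𝒪`-admissible datum `(I ∋ p, κ)` ON `X` with `κ_p = a·w + c_p·θᵖ`, `a ≠ 0`, `κ_q = c_q·θ^q` (`q ∈ I`, `q ≠ p`) — PART Z's pinned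
  design `PinnedDesignAt 𝒪 n p` LOCALISED to the anchor locus (Bloch's form `a·z₀ + b·l₀ᵖ`).

The companion proof file `VHCAbelianSchemesRoadServedFibre` proves, door-, degree- and anchor-generically and fact-free: the partition and
its converse; `AnchoredCarrierAt 𝒪 n p 𝔄 𝔖 → LefAtExceptionalRegimeAtUnder 𝒪 n p (HasServedFibre n p 𝔄 𝔖)` (transport along pencils
through an anchor, PART Z-b §5); hence «anchored carrier ∧ residual ⟹ cell»; monotonicity in `(𝔄, 𝔖)` (enlarging the served set strengthens
the carrier statement and weakens the residual); the necessity of a carrier modulo Lefschetz classes at every anchor (constant pencil); and the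
two extremes (no anchors: residual = cell; every polarised abelian `n`-fold an anchor serving its algebraic classes: residual vacuous, PART Z-b
§2). The intended first instance (ring2 LEAD gen 151 nod N1–N8 for the `(6, 3)` rung of crux 19787): `𝔄 :=` Markman's secant anchors
`Pic²(C) × Pic²(C)^` with their product polarisation, `𝔖 :=` the honestly served `(3,3)`-classes there — typed by the road's seat, NOT here.

All three constants are predicates with parameters; `LefAtExceptionalRegimeAtUnder` and `AnchoredCarrierAt` are OPEN statements in every
intended instance, HYPOTHESES wherever used, tagged `@[conjecture]` like the cells; nothing here says any of them, any cell, K-SR♭∃, VHC,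
`HC_AV` or HC holds. References: [cite: Bloch1972Semiregularity, Remark (7.5)] [cite: BuchweitzFlenner2003, §5 Thm. 5.1]
[cite: vanGeemen1994HodgeAV, §2.4 and Thm. 4.11] [cite: Markman2025SecantWeil, Thm. 1.4.1 and Thm. 1.5.1] [cite: Andre1996Motifs, §1.1 (p. 10)].
-/

noncomputable section

open CategoryTheory CategoryTheory.Limits AlgebraicGeometry Topology

namespace Summit.HodgeConjecture.HodgeConjecture.Ring2.SemiregularRepresentatives

-- the cell's namespace repeats the summit name (`Summit.HodgeConjecture.HodgeConjecture…`), as in every `Ring2*` file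
set_option linter.dupNamespace false

open Literature.AlgebraicGeometry Literature.AlgebraicGeometry.Motives
open Literature.AlgebraicGeometry.HodgeTheory
open Literature.AlgebraicTopology.SingularHomology
open Literature.Barriers.HodgeConjecture (divisorClassesSpan)
open Summit.Ventures.HSemireg (ObjClass)

/-- **Regime 2 of K-SR♭∃ for the door `𝒪` at `(n, p)` UNDER the pencil-level hypothesis `P` (`LefAtExceptionalRegimeAtUnder 𝒪 n p P`)**:
the body of `LefAtExceptionalRegimeAt 𝒪 n p` VERBATIM (one-parameter abelian scheme `f : 𝒳 ⟶ S` of relative dimension `n` over a smooth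
irreducible affine curve with a section; a fibrewise rational `(p,p)` global class `W`, algebraic at `s₀`, NOT algebraic-Lefschetz on every
fibre) with the extra hypothesis `P f W` inserted before the conclusion (an `𝒪`-admissible datum at SOME fibre with `κ_p = a·W| + Z|`, `a ≠ 0`,
`Z` fibrewise algebraic-Lefschetz). `…Under 𝒪 n p P ∧ …Under 𝒪 n p (¬P) ↔ LefAtExceptionalRegimeAt 𝒪 n p` by excluded middle (companion
file). OPEN for the road's doors in the middle range whenever `P` is satisfiable there; a HYPOTHESIS wherever used.
[cite: vanGeemen1994HodgeAV, §2.4 and Thm. 4.11] [cite: Bloch1972Semiregularity, Remark (7.5)] [cite: BuchweitzFlenner2003, §5 Thm. 5.1] -/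
@[conjecture] def LefAtExceptionalRegimeAtUnder (𝒪 : ObjClass) (n p : ℕ)
    (P : ∀ ⦃𝒳 S : SchemeOver ℂ⦄, (𝒳 ⟶ S) → complexBetti 𝒳 (2 * p) → Prop) : Prop :=
  ∀ ⦃𝒳 S : SchemeOver ℂ⦄ (f : 𝒳 ⟶ S), IsSmoothProjectiveFamily f n → IsQuasiProjectiveOver 𝒳 →
    IrreducibleSpace S.left → IsAffine S.left → AlgebraicGeometry.Smooth S.hom → topologicalKrullDim S.left = 1 →
    (∀ s : ComplexPoints S, ∃ A' : AbelianVariety ℂ, A'.dim = n ∧ Nonempty (A'.X ≅ fiberOver f s)) →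
    (∃ e : S ⟶ 𝒳, e ≫ f = 𝟙 S) →
    ∀ (W : complexBetti 𝒳 (2 * p)),
      (∀ s : ComplexPoints S, IsRationalClass (complexBetti.map (fiberι f s) (2 * p) W) ∧
        IsOfHodgeType n (fiberOver f s) (2 * p) p p (complexBetti.map (fiberι f s) (2 * p) W)) →
      ∀ s₀ : ComplexPoints S,
        complexBetti.map (fiberι f s₀) (2 * p) W ∈ algebraicClasses (fiberOver f s₀) p →
        (¬ ∀ s : ComplexPoints S,
          complexBetti.map (fiberι f s) (2 * p) W ∈ algebraicClasses (fiberOver f s) p ∧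
          complexBetti.map (fiberι f s) (2 * p) W ∈ divisorClassesSpan (fiberOver f s) n p) →
        P f W →
        ∃ (s₁ : ComplexPoints S) (I : Finset ℕ) (κ : (q : ℕ) → complexBetti (fiberOver f s₁) (2 * q))
          (V : (q : ℕ) → complexBetti 𝒳 (2 * q)) (a : ℂ) (Z : complexBetti 𝒳 (2 * p)),
          p ∈ I ∧ 𝒪 n (fiberOver f s₁) I κ ∧ a ≠ 0 ∧
          (∀ s : ComplexPoints S,
            complexBetti.map (fiberι f s) (2 * p) Z ∈ algebraicClasses (fiberOver f s) p ∧
            complexBetti.map (fiberι f s) (2 * p) Z ∈ divisorClassesSpan (fiberOver f s) n p) ∧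
          V p = a • W + Z ∧
          (∀ q ∈ I, κ q = complexBetti.map (fiberι f s₁) (2 * q) (V q)) ∧
          (∀ q ∈ I, ∀ s : ComplexPoints S,
            IsOfHodgeType n (fiberOver f s) (2 * q) q q (complexBetti.map (fiberι f s) (2 * q) (V q)))

/-- **The pencil `f` has a SERVED FIBRE for the class `W` w.r.t. the anchor predicate `𝔄` and the served-class map `𝔖`
(`HasServedFibre n p 𝔄 𝔖 f W`)**: there are a point `sₐ` of the base and a GLOBAL class `Θ ∈ H²(𝒳(ℂ); ℂ)` whose restriction to EVERY
fibre is rational of type `(1,1)`, such that the fibre `𝒳_{sₐ}` with the class `Θ|_{sₐ}` is an anchor (`𝔄`) and the restriction `W|_{sₐ}`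
is a served class there (`𝔖`). A plain predicate on `(f, W)` — the partition variable of the companion file; no statement by itself. The
global `Θ` carries the side components `c_q·Θ^q` of the transported datum (PART Z-b §5). [cite: Bloch1972Semiregularity, Remark (7.5)]
[cite: Markman2025SecantWeil, Thm. 1.4.1] [cite: VoisinHodgeI2002, §7.1.2] -/
def HasServedFibre (n p : ℕ) (𝔄 : ∀ X : SchemeOver ℂ, complexBetti X 2 → Prop)
    (𝔖 : ∀ (X : SchemeOver ℂ), complexBetti X 2 → Set (complexBetti X (2 * p)))
    ⦃𝒳 S : SchemeOver ℂ⦄ (f : 𝒳 ⟶ S) (W : complexBetti 𝒳 (2 * p)) : Prop :=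
  ∃ (sₐ : ComplexPoints S) (Θ : complexBetti 𝒳 2),
    (∀ s : ComplexPoints S, IsRationalClass (complexBetti.map (fiberι f s) 2 Θ)) ∧
    (∀ s : ComplexPoints S, IsOfHodgeType n (fiberOver f s) 2 1 1 (complexBetti.map (fiberι f s) 2 Θ)) ∧
    𝔄 (fiberOver f sₐ) (complexBetti.map (fiberι f sₐ) 2 Θ) ∧
    complexBetti.map (fiberι f sₐ) (2 * p) W ∈ 𝔖 (fiberOver f sₐ) (complexBetti.map (fiberι f sₐ) 2 Θ)

/-- **The ANCHORED CARRIER STATEMENT of the cell `(n, p)` for the door `𝒪`, the anchor predicate `𝔄` and the served-class map `𝔖`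
(`AnchoredCarrierAt 𝒪 n p 𝔄 𝔖`)**: at every anchor `(X, θ)` (`𝔄 X θ`) and every served class `w ∈ 𝔖 X θ` that is RATIONAL, there are
degrees `I ∋ p`, classes `κ` admissible for `𝒪` ON `X`, `a ≠ 0` and scalars `c_q` with `κ_p = a·w + c_p·θᵖ` and `κ_q = c_q·θ^q` for
`q ∈ I`, `q ≠ p` — PART Z's pinned design problem `PinnedDesignAt 𝒪 n p` LOCALISED to the anchor locus (Bloch's `a·z₀ + b·l₀ᵖ`, every side
component on the `θ`-ray). SUFFICIENT for the cell on every pencil with a served fibre (companion file); in the intended first instance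
(Markman's secant anchors at `(6, 3)`, twisted door) citation-expected from a PREPRINT; OPEN; a HYPOTHESIS wherever used.
[cite: Bloch1972Semiregularity, Remark (7.5)] [cite: Markman2025SecantWeil, Thm. 1.4.1] [cite: Andre1996Motifs, §1.1 (p. 10)] -/
@[conjecture] def AnchoredCarrierAt (𝒪 : ObjClass) (n p : ℕ) (𝔄 : ∀ X : SchemeOver ℂ, complexBetti X 2 → Prop)
    (𝔖 : ∀ (X : SchemeOver ℂ), complexBetti X 2 → Set (complexBetti X (2 * p))) : Prop :=
  ∀ (X : SchemeOver ℂ) (θ : complexBetti X 2), 𝔄 X θ →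
    ∀ w ∈ 𝔖 X θ, IsRationalClass w →
      ∃ (I : Finset ℕ) (κ : (q : ℕ) → complexBetti X (2 * q)) (a : ℂ) (c : ℕ → ℂ),
        p ∈ I ∧ 𝒪 n X I κ ∧ a ≠ 0 ∧ κ p = a • w + c p • cupPowTwo θ p ∧
        ∀ q ∈ I, q ≠ p → κ q = c q • cupPowTwo θ q

end Summit.HodgeConjecture.HodgeConjecture.Ring2.SemiregularRepresentatives

end
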